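import Mathlib
import Summits.MatrixMultiplication.MatrixMultiplication.Theorems.GradedDesignFamily.Negative.SL2Generators

/-!
# Unipotent elements in the quadratic-extension cell: `2 × 2` matrix lemmas
# (crux `LevelGradedCohnUmans.GradedDesignFamily`, stmt-MatrixMultiplication-7610; negative side,
# line `quadratic-extension-level-one-cell`, stub S3 `stub_subfieldCell`)

HONEST FRAMING.  Support lemmas for DECIDING the finite cells `q = 4, 5` of S3 by theorem (the
cusp-form wall); not summit progress.

S3 lets `φ : SL₂(k) →* GL₂(K)` be an ARBITRARY injective hom with `|K| = |k|²`.  This file proves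
the structural facts about such `φ` that the orbit count needs, by elementary `2 × 2` algebra:

* `fin_two_exists_smul_of_mulVec_eq_zero` — a non-zero `2 × 2` matrix kills at most one line;
* `fin_two_mul_self` — Cayley–Hamilton, `N² = tr(N) N − det(N) 1`;
* `fin_two_sq_eq_zero_of_pow_eq_zero` — a nilpotent `2 × 2` matrix has square zero;
* `fin_two_sub_one_sq_of_fixed` — `det M = 1`, `M v = v ≠ 0` ⟹ `(M − 1)² = 0`;
* `fin_two_one_add_pow` — `N² = 0` ⟹ `(1 + N)ⁿ = 1 + n N`;
* `fin_two_commuting_sqZero_mulVec` — commuting square-zero `N ≠ 0`, `N'` with `N v = 0 ≠ v`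
  force `N' v = 0` (the fixed line of an abelian unipotent group);
* `subfieldCell_charP` — `|K| = |k|²` ⟹ `char K = char k`;
* `subfieldCell_upper_pow`, `subfieldCell_det_eq_one` — `u_x^n = u_{n x}`, and `det ∘ φ = 1`
  (orders: `u_x^p = 1` while `p ∤ |Kˣ|`; `SL₂(k) = ⟨u, l⟩`, `sl2md_decomp`);
* `subfieldCell_pow_char_of_fixed` — if `φ(s)` fixes a non-zero vector then `s^p = 1`;
* `subfieldCell_sub_one_sq_of_pow_char` — `s^p = 1` ⟹ `(φ(s) − 1)² = 0`.

Sorry-free; axioms `propext`, `Classical.choice`, `Quot.sound`.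
-/

set_option linter.dupNamespace false

open scoped BigOperators
open Matrix

namespace Summit.MatrixMultiplication.MatrixMultiplication.Theorems.GradedDesignFamily.Negative

section FinTwo

variable {K : Type} [Field K]

/-- A non-zero `2 × 2` matrix over a field kills at most one line: if `N ≠ 0`, `N v₀ = 0` with
`v₀ ≠ 0` and `N v = 0`, then `v = c • v₀`. [folklore] -/
theorem fin_two_exists_smul_of_mulVec_eq_zero (N : Matrix (Fin 2) (Fin 2) K) (hN : N ≠ 0)
    (v₀ v : Fin 2 → K) (hv₀ : v₀ ≠ 0) (h₀ : N *ᵥ v₀ = 0) (h : N *ᵥ v = 0) :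
    ∃ c : K, v = c • v₀ := by
  have e₀ : ∀ i, N i 0 * v₀ 0 + N i 1 * v₀ 1 = 0 := fun i => by
    have := congr_fun h₀ i
    simpa [Matrix.mulVec, dotProduct, Fin.sum_univ_two] using this
  have e : ∀ i, N i 0 * v 0 + N i 1 * v 1 = 0 := fun i => by
    have := congr_fun h i
    simpa [Matrix.mulVec, dotProduct, Fin.sum_univ_two] using this
  -- the `2 × 2` minor `v₀ ∧ v` vanishes
  have hD : v₀ 0 * v 1 - v 0 * v₀ 1 = 0 := by
    by_contra hD
    apply hN
    ext i j
    have hi0 : N i 0 * (v₀ 0 * v 1 - v 0 * v₀ 1) = 0 := by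
      linear_combination (v 1) * e₀ i - (v₀ 1) * e i
    have hi1 : N i 1 * (v₀ 0 * v 1 - v 0 * v₀ 1) = 0 := by
      linear_combination (v₀ 0) * e i - (v 0) * e₀ i
    fin_cases j
    · simpa [hD] using hi0
    · simpa [hD] using hi1
  by_cases hx : v₀ 0 = 0
  · have hy : v₀ 1 ≠ 0 := by
      intro hy
      apply hv₀
      funext i
      fin_cases i
      · exact hx
      · exact hy
    refine ⟨v 1 / v₀ 1, funext fun i => ?_⟩
    fin_cases i
    · have : v 0 * v₀ 1 = 0 := by linear_combination (-1 : K) * hD + (v 1) * hx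
      simpa [hx, hy] using this
    · simp [hy]
  · refine ⟨v 0 / v₀ 0, funext fun i => ?_⟩
    fin_cases i
    · simp [hx]
    · have : v 1 = v 0 / v₀ 0 * v₀ 1 := by
        field_simp
        linear_combination hD
      simpa using this

/-- Cayley–Hamilton for `2 × 2` matrices: `N² = tr(N) • N − det(N) • 1`. [folklore] -/
theorem fin_two_mul_self (N : Matrix (Fin 2) (Fin 2) K) :
    N * N = (N 0 0 + N 1 1) • N - (N 0 0 * N 1 1 - N 0 1 * N 1 0) • (1 : Matrix (Fin 2) (Fin 2) K) := by
  ext i j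
  fin_cases i <;> fin_cases j <;> simp [Matrix.mul_apply, Fin.sum_univ_two] <;> ring

/-- A nilpotent `2 × 2` matrix has square zero. [folklore] -/
theorem fin_two_sq_eq_zero_of_pow_eq_zero (N : Matrix (Fin 2) (Fin 2) K) (m : ℕ) (hm : N ^ m = 0) :
    N * N = 0 := by
  have hdet : N 0 0 * N 1 1 - N 0 1 * N 1 0 = 0 := by
    have h1 : N.det ^ m = 0 := by rw [← Matrix.det_pow, hm]; cases m with
      | zero => exact absurd hm (by simp)
      | succ m => simp
    have h2 : N.det = 0 := pow_eq_zero_iff' |>.1 h1 |>.1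
    rwa [Matrix.det_fin_two] at h2
  have hsq : N * N = (N 0 0 + N 1 1) • N := by
    rw [fin_two_mul_self, hdet, zero_smul, sub_zero]
  -- `N^(j+1) = t^j • N`
  have hpow : ∀ j : ℕ, N ^ (j + 1) = (N 0 0 + N 1 1) ^ j • N := by
    intro j
    induction j with
    | zero => simp
    | succ j ih => rw [pow_succ, ih, smul_mul_assoc, hsq, smul_smul, pow_succ]
  cases m with
  | zero => exact absurd hm (by simp)
  | succ m =>
    rw [hpow] at hm
    rcases smul_eq_zero.1 hm with ht | hN
    · rw [hsq, pow_eq_zero_iff'.1 ht |>.1, zero_smul]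
    · rw [hN, mul_zero]

/-- If `det M = 1` and `M` fixes a non-zero vector, then `(M − 1)² = 0` (`M` is unipotent).
[folklore] -/
theorem fin_two_sub_one_sq_of_fixed (M : Matrix (Fin 2) (Fin 2) K) (hdet : M.det = 1)
    (v : Fin 2 → K) (hv : v ≠ 0) (h : M *ᵥ v = v) : (M - 1) * (M - 1) = 0 := by
  rw [Matrix.det_fin_two] at hdet
  have e : ∀ i, M i 0 * v 0 + M i 1 * v 1 = v i := fun i => by
    have := congr_fun h i
    simpa [Matrix.mulVec, dotProduct, Fin.sum_univ_two] using this
  have e0 := e 0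
  have e1 := e 1
  -- `E := (M₀₀ - 1)(M₁₁ - 1) - M₀₁ M₁₀` kills `v`, hence vanishes
  have hE : (M 0 0 - 1) * (M 1 1 - 1) - M 0 1 * M 1 0 = 0 := by
    have hx : ((M 0 0 - 1) * (M 1 1 - 1) - M 0 1 * M 1 0) * v 0 = 0 := by
      linear_combination (M 1 1 - 1) * e0 - (M 0 1) * e1
    have hy : ((M 0 0 - 1) * (M 1 1 - 1) - M 0 1 * M 1 0) * v 1 = 0 := by
      linear_combination (M 0 0 - 1) * e1 - (M 1 0) * e0
    by_contra hne
    apply hv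
    funext i
    fin_cases i
    · simpa [hne] using hx
    · simpa [hne] using hy
  ext i j
  fin_cases i <;> fin_cases j <;>
    simp [Matrix.mul_apply, Fin.sum_univ_two, Matrix.one_apply]
  · linear_combination (M 0 0 - 1) * hdet - (M 0 0) * hE
  · linear_combination (M 0 1) * hdet - (M 0 1) * hE
  · linear_combination (M 1 0) * hdet - (M 1 0) * hE
  · linear_combination (M 1 1 - 1) * hdet - (M 1 1) * hE

/-- `N² = 0` ⟹ `(1 + N)ⁿ = 1 + n • N`. [folklore] -/
theorem fin_two_one_add_pow (N : Matrix (Fin 2) (Fin 2) K) (hN : N * N = 0) (n : ℕ) :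
    (1 + N) ^ n = 1 + (n : K) • N := by
  induction n with
  | zero => simp
  | succ n ih =>
    rw [pow_succ, ih]
    simp only [add_mul, mul_add, one_mul, mul_one, smul_mul_assoc, hN, smul_zero, add_zero,
      Nat.cast_succ, add_smul, one_smul]
    abel

/-- The fixed line of an abelian unipotent group: if `N ≠ 0` and `N'` are commuting square-zero
`2 × 2` matrices (only `N'² = 0` is needed) and `N v = 0` with `v ≠ 0`, then `N' v = 0`.
[folklore] -/
theorem fin_two_commuting_sqZero_mulVec (N N' : Matrix (Fin 2) (Fin 2) K) (hN : N ≠ 0)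
    (hN' : N' * N' = 0) (hc : N * N' = N' * N) (v : Fin 2 → K) (hv : v ≠ 0) (h : N *ᵥ v = 0) :
    N' *ᵥ v = 0 := by
  have h1 : N *ᵥ (N' *ᵥ v) = 0 := by
    rw [Matrix.mulVec_mulVec, hc, ← Matrix.mulVec_mulVec, h, Matrix.mulVec_zero]
  obtain ⟨c, hc'⟩ := fin_two_exists_smul_of_mulVec_eq_zero N hN v (N' *ᵥ v) hv h h1
  have h2 : (c * c) • v = 0 := by
    have : (N' * N') *ᵥ v = 0 := by rw [hN', Matrix.zero_mulVec]
    rwa [← Matrix.mulVec_mulVec, hc', Matrix.mulVec_smul, hc', smul_smul] at this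
  rcases smul_eq_zero.1 h2 with hcc | hv0
  · rw [hc', mul_self_eq_zero.1 hcc, zero_smul]
  · exact absurd hv0 hv

end FinTwo

section Cell

variable {k K : Type} [Field k] [Fintype k] [DecidableEq k] [Field K] [Fintype K] [DecidableEq K]

omit [DecidableEq k] [DecidableEq K] in
/-- In the quadratic-extension cell (`|K| = |k|²`) the two characteristics agree:
`char K = char k`. [folklore] -/
theorem subfieldCell_charP (hK : Fintype.card K = Fintype.card k ^ 2) : CharP K (ringChar k) := by
  obtain ⟨n, hp, hk⟩ := FiniteField.card k (ringChar k)
  obtain ⟨m, hℓ, hKm⟩ := FiniteField.card K (ringChar K)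
  have hdvd : ringChar K ∣ ringChar k ^ (2 * (n : ℕ)) := by
    have h1 : ringChar K ∣ Fintype.card K := by
      rw [hKm]; exact dvd_pow_self _ (PNat.ne_zero m)
    rw [hK, hk, ← pow_mul, mul_comm] at h1
    exact h1
  have heq : ringChar K = ringChar k :=
    (Nat.prime_dvd_prime_iff_eq hℓ hp).1 (hℓ.dvd_of_dvd_pow hdvd)
  exact ringChar.eq_iff.1 heq

omit [Fintype k] [DecidableEq k] in
/-- Powers of a transvection: `u_x^n = u_{n x}`. [folklore] -/
theorem subfieldCell_upper_pow (x : k) (n : ℕ) :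
    (⟨_, sl2md_det_upper x⟩ ^ n : Matrix.SpecialLinearGroup (Fin 2) k) =
      ⟨_, sl2md_det_upper ((n : k) * x)⟩ := by
  induction n with
  | zero => rw [pow_zero, Nat.cast_zero, zero_mul]; exact sl2md_upper_zero.symm
  | succ n ih => rw [pow_succ, ih, sl2md_upper_mul, Nat.cast_succ, add_mul, one_mul]

omit [Fintype k] [DecidableEq k] in
/-- `u_x^p = 1`, `p = char k`. [folklore] -/
theorem subfieldCell_upper_pow_char (x : k) :
    (⟨_, sl2md_det_upper x⟩ ^ ringChar k : Matrix.SpecialLinearGroup (Fin 2) k) = 1 := by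
  rw [subfieldCell_upper_pow, ringChar.Nat.cast_ringChar, zero_mul]
  exact sl2md_upper_zero

omit [DecidableEq k] in
/-- **`det ∘ φ = 1`.**  For any hom `φ : SL₂(k) →* GL₂(K)` with `|K| = |k|²`, every `φ(a)` has
determinant `1`: `det φ(u_x)` has order dividing both `p` (`u_x^p = 1`) and `|Kˣ| = |K| − 1`
(coprime to `p ∣ |K|`), the `l_x` are conjugate to the `u_{−x}` (`sl2md_weyl_mul_upper`), and
`SL₂(k) = u l u l` (`sl2md_decomp`). [folklore] -/
theorem subfieldCell_det_eq_one
    (φ : Matrix.SpecialLinearGroup (Fin 2) k →* Matrix.GeneralLinearGroup (Fin 2) K)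
    (hK : Fintype.card K = Fintype.card k ^ 2) (a : Matrix.SpecialLinearGroup (Fin 2) k) :
    Matrix.det ((φ a : Matrix.GeneralLinearGroup (Fin 2) K) : Matrix (Fin 2) (Fin 2) K) = 1 := by
  classical
  set p := ringChar k with hp_def
  haveI hprime : Fact p.Prime := ⟨CharP.char_is_prime k p⟩
  obtain ⟨n, -, hk⟩ := FiniteField.card k p
  let χ : Matrix.SpecialLinearGroup (Fin 2) k →* Kˣ := Matrix.GeneralLinearGroup.det.comp φ
  -- `p` is coprime to `|Kˣ| = |K| - 1`
  have hcop : Nat.Coprime p (Fintype.card Kˣ) := by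
    rw [Fintype.card_units, Nat.Prime.coprime_iff_not_dvd hprime.out]
    intro hd
    have hpK : p ∣ Fintype.card K := by
      rw [hK, hk, ← pow_mul]
      exact dvd_pow_self _ (by positivity)
    have h1 : p ∣ Fintype.card K - (Fintype.card K - 1) := Nat.dvd_sub hpK hd
    have hKpos : 0 < Fintype.card K := Fintype.card_pos
    rw [show Fintype.card K - (Fintype.card K - 1) = 1 by omega] at h1
    exact hprime.out.one_lt.ne' (Nat.dvd_one.1 h1)
  -- `χ(u_x) = 1`
  have hu : ∀ x : k, χ ⟨_, sl2md_det_upper x⟩ = 1 := by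
    intro x
    have h1 : χ ⟨_, sl2md_det_upper x⟩ ^ p = 1 := by
      rw [← map_pow, subfieldCell_upper_pow_char, map_one]
    have h2 : χ ⟨_, sl2md_det_upper x⟩ ^ Fintype.card Kˣ = 1 := pow_card_eq_one
    have h3 := Nat.eq_one_of_dvd_coprimes hcop (orderOf_dvd_of_pow_eq_one h1)
      (orderOf_dvd_of_pow_eq_one h2)
    exact orderOf_eq_one_iff.1 h3
  -- `χ(l_x) = 1`
  have hl : ∀ x : k, χ ⟨_, sl2md_det_lower x⟩ = 1 := by
    intro x
    have h1 := congrArg χ (sl2md_weyl_mul_upper x)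
    rw [map_mul, map_mul, hu, mul_one] at h1
    -- `χ w = χ l_x * χ w`
    have h2 : χ ⟨_, sl2md_det_lower x⟩ * χ ⟨_, sl2md_det_weyl⟩ = 1 * χ ⟨_, sl2md_det_weyl⟩ := by
      rw [one_mul]; exact h1.symm
    exact mul_right_cancel h2
  obtain ⟨a₁, b₁, c₁, d₁, rfl⟩ := sl2md_decomp a
  have hχ : χ (⟨_, sl2md_det_upper a₁⟩ * ⟨_, sl2md_det_lower c₁⟩ * ⟨_, sl2md_det_upper b₁⟩ *
      ⟨_, sl2md_det_lower d₁⟩) = 1 := by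
    rw [map_mul, map_mul, map_mul, hu, hl, hu, hl]; simp
  have := congrArg (fun u : Kˣ => (u : K)) hχ
  simpa [χ, Matrix.GeneralLinearGroup.val_det_apply] using this

omit [DecidableEq k] in
/-- **Fixed vector ⟹ order `p`.**  If `φ` is injective, `|K| = |k|²`, and `φ(s)` fixes a non-zero
vector of `K²`, then `s^p = 1` (`p = char k`): `φ(s)` is unipotent (`det = 1`, eigenvalue `1`),
so `φ(s)^p = (1 + N)^p = 1 + pN = 1`. [folklore] -/
theorem subfieldCell_pow_char_of_fixed
    (φ : Matrix.SpecialLinearGroup (Fin 2) k →* Matrix.GeneralLinearGroup (Fin 2) K)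
    (hφ : Function.Injective φ) (hK : Fintype.card K = Fintype.card k ^ 2)
    (s : Matrix.SpecialLinearGroup (Fin 2) k) (v : Fin 2 → K) (hv : v ≠ 0)
    (h : ((φ s : Matrix.GeneralLinearGroup (Fin 2) K) : Matrix (Fin 2) (Fin 2) K) *ᵥ v = v) :
    s ^ ringChar k = 1 := by
  set p := ringChar k with hp_def
  haveI : CharP K p := subfieldCell_charP hK
  set M : Matrix (Fin 2) (Fin 2) K :=
    ((φ s : Matrix.GeneralLinearGroup (Fin 2) K) : Matrix (Fin 2) (Fin 2) K) with hM
  have hN : (M - 1) * (M - 1) = 0 :=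
    fin_two_sub_one_sq_of_fixed M (subfieldCell_det_eq_one φ hK s) v hv h
  have hMp : M ^ p = 1 := by
    have : M = 1 + (M - 1) := by abel
    rw [this, fin_two_one_add_pow (M - 1) hN p, CharP.cast_eq_zero, zero_smul, add_zero]
  apply hφ
  rw [map_pow, map_one]
  ext1
  rw [Units.val_pow_eq_pow_val, ← hM, hMp, Units.val_one]

omit [DecidableEq k] [DecidableEq K] in
/-- **Order `p` ⟹ unipotent image.**  If `|K| = |k|²` and `s^p = 1` then `(φ(s) − 1)² = 0`:
`(φ(s) − 1)^p = φ(s)^p − 1 = 0` in characteristic `p`, and a nilpotent `2 × 2` matrix has square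
zero. [folklore] -/
theorem subfieldCell_sub_one_sq_of_pow_char
    (φ : Matrix.SpecialLinearGroup (Fin 2) k →* Matrix.GeneralLinearGroup (Fin 2) K)
    (hK : Fintype.card K = Fintype.card k ^ 2) (s : Matrix.SpecialLinearGroup (Fin 2) k)
    (hs : s ^ ringChar k = 1) :
    (((φ s : Matrix.GeneralLinearGroup (Fin 2) K) : Matrix (Fin 2) (Fin 2) K) - 1) *
      (((φ s : Matrix.GeneralLinearGroup (Fin 2) K) : Matrix (Fin 2) (Fin 2) K) - 1) = 0 := by
  set p := ringChar k with hp_def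
  haveI hprime : Fact p.Prime := ⟨CharP.char_is_prime k p⟩
  haveI : CharP K p := subfieldCell_charP hK
  set M : Matrix (Fin 2) (Fin 2) K :=
    ((φ s : Matrix.GeneralLinearGroup (Fin 2) K) : Matrix (Fin 2) (Fin 2) K) with hM
  have hMp : M ^ p = 1 := by
    have h1 := congrArg (fun u : Matrix.GeneralLinearGroup (Fin 2) K => (u : Matrix (Fin 2) (Fin 2) K))
      (map_pow φ s p)
    simp only [hs, map_one, Units.val_one, Units.val_pow_eq_pow_val] at h1
    rw [hM]; exact h1.symm
  have hnil : (M - 1) ^ p = 0 := by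
    rw [sub_pow_char_of_commute p (Commute.one_right M), hMp, one_pow, sub_self]
  exact fin_two_sq_eq_zero_of_pow_eq_zero (M - 1) p hnil

end Cell

end Summit.MatrixMultiplication.MatrixMultiplication.Theorems.GradedDesignFamily.Negative
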